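import Mathlib.Analysis.InnerProductSpace.LaxMilgram
import Mathlib.Analysis.InnerProductSpace.Adjoint
import Mathlib.Analysis.Normed.Operator.Compact.FredholmAlternative
import Literature.Analysis.FluidPDE.PineauVicolGaussSobolev
import Literature.Analysis.FluidPDE.SobolevWholeSpace
import Literature.Analysis.FunctionSpaces.SobolevDomainProofs
import HarnessLib

/-!
# A nonzero weak solution of `L*(γv) = 0` in `H¹(γ)` (tools for Pineau–Vicol 2026, Prop. 5.1)

Analysis/FluidPDE support file (all results proved; no named facts), second of four files
realising the positive weight of **Proposition 5.1** of B. Pineau, V. Vicol, arXiv:2607.09619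
(2026) (used in the discharge of `Literature.Analysis.FluidPDE.pineauVicol2026_rdss_liouville`,
Thm. 1.7 there) by the `L²(γ)` route described in `PineauVicolGaussSobolev`:

* **compactness of `V = H¹(γ) ↪ L²(γ)`** (`isCompactOperator_gaussFstL`): uniform Gaussian tails
  (previous file) + the tree's `C¹` Rellich lemma on balls
  (`FunctionSpaces.exists_subseq_tendsto_eLpNorm_of_contDiff`) via truncations `truncTest`, giving
  total boundedness of the image of the unit ball of `V`;
* the **shifted bilinear form** of `M v = −Δv + (½y − U)·∇v + ½(U·y)v` on `V`
  (`formBilin`, `formBilinV`; multiplication operators `mulInnerL`, `mulPotL`), its coercivity for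
  the shift `shiftConst = C₀² + C₀ + 1` (`isCoercive_formBilinV`) and the Lax–Milgram solution
  operator `solOp`, compact as a map of `L²(γ)` (`isCompactOperator_solOp`);
* the hypothesis record **`DriftHyp U C₀`** (`U` smooth, divergence free, `|U| ≤ C₀`,
  `|U·y| ≤ C₀` — (1.9) and (2.1) of the source with one constant) and, under it, the operator
  `K` with `K†1 = μ₀⁻¹ 1` (`adjoint_K_gaussOne`: the adjoint form kills the constant because
  `div U = 0`), hence `μ₀⁻¹ ∈ σ_p(K)` by the **Fredholm alternative** (`hasEigenvalue_K`) and a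
  nonzero weak solution `(f, G) ∈ V` of `M f = 0` (`exists_weak_solution`,
  `exists_weak_solution_fun`: `∫ γ (⟪G, ∇φ⟫ + (∇φ·(½y − U)) f… ) = 0` for all test functions).

## References

* B. Pineau, V. Vicol, arXiv:2607.09619 (2026), Prop. 5.1, Remark 5.2, (6.7). [PineauVicol2026]
* L. C. Evans, *Partial Differential Equations*, 2nd ed. (2010), §6.2 (Lax–Milgram, Fredholm
  alternative for elliptic operators). [Evans2010]
-/

noncomputable section

open MeasureTheory TopologicalSpace Set Function Filter Topology InnerProductSpace Real
open scoped RealInnerProductSpace ENNReal NNReal ContDiff Distributions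

namespace Literature.Analysis.FluidPDE

namespace PineauVicol2026

variable {E : Type*} [NormedAddCommGroup E] [InnerProductSpace ℝ E] [FiniteDimensional ℝ E]
  [MeasurableSpace E] [BorelSpace E]

/-! ## F2: compactness of `V ↪ L²(γ)` -/

section Compactness

/-- `μ_γ ≤ dy` (the density is `≤ 1`). [folklore] -/
theorem gaussMeasure_le_volume : gaussMeasure (E := E) ≤ volume := by
  have h : gaussMeasure (E := E) ≤ (volume : Measure E).withDensity (fun _ => 1) := by
    refine withDensity_mono (Eventually.of_forall fun y => ?_)
    have := gaussWeight_le_one y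
    simp only [ENNReal.coe_le_one_iff]
    exact this
  simpa using h

/-- The truncation `χ_R φ` of a test function, again a test function. [folklore] -/
def truncTest (R : ℝ) (φ : 𝓓((⊤ : Opens E), ℝ)) : 𝓓((⊤ : Opens E), ℝ) :=
  mkTest (fun y => cutoff R y * φ y) ((contDiff_cutoff R).mul φ.contDiff)
    (φ.hasCompactSupport.mul_left)

omit [FiniteDimensional ℝ E] [MeasurableSpace E] [BorelSpace E] in
/-- Unfolding the truncation. [folklore] -/
@[simp] theorem coe_truncTest (R : ℝ) (φ : 𝓓((⊤ : Opens E), ℝ)) :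
    (truncTest R φ : E → ℝ) = fun y => cutoff R y * φ y := rfl

omit [FiniteDimensional ℝ E] [MeasurableSpace E] [BorelSpace E] in
/-- The truncation is supported in the closed ball of radius `2R`. [folklore] -/
theorem tsupport_truncTest_subset {R : ℝ} (hR : 0 < R) (φ : 𝓓((⊤ : Opens E), ℝ)) :
    tsupport (truncTest R φ : E → ℝ) ⊆ Metric.closedBall (0 : E) (2 * R) := by
  rw [coe_truncTest]
  refine closure_minimal (fun y hy => ?_) Metric.isClosed_closedBall
  rw [Metric.mem_closedBall, dist_zero_right]
  by_contra h
  exact hy (by simp [cutoff_eq_zero hR (not_le.mp h).le])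

omit [FiniteDimensional ℝ E] [MeasurableSpace E] [BorelSpace E] in
/-- The derivative of the truncation vanishes off the closed ball of radius `2R`. [folklore] -/
theorem fderiv_truncTest_eq_zero {R : ℝ} (hR : 0 < R) (φ : 𝓓((⊤ : Opens E), ℝ)) {y : E}
    (hy : 2 * R < ‖y‖) : fderiv ℝ (truncTest R φ : E → ℝ) y = 0 := by
  refine image_eq_zero_of_notMem_tsupport fun h => ?_
  have h' := tsupport_truncTest_subset hR φ (tsupport_fderiv_subset ℝ h)
  rw [Metric.mem_closedBall, dist_zero_right] at h'
  linarith

omit [InnerProductSpace ℝ E] [FiniteDimensional ℝ E] [MeasurableSpace E] [BorelSpace E] in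
/-- On the ball of radius `2R`, `1 ≤ e^{R²} γ`. [folklore] -/
theorem one_le_exp_mul_gaussWeight {R : ℝ} {y : E} (hy : ‖y‖ ≤ 2 * R) :
    1 ≤ Real.exp (R ^ 2) * gaussWeight y := by
  rw [gaussWeight, ← Real.exp_add]
  apply Real.one_le_exp
  nlinarith [norm_nonneg y, sq_nonneg (‖y‖ - 2 * R)]

omit [FiniteDimensional ℝ E] [MeasurableSpace E] [BorelSpace E] in
/-- `φ²` has compact support. [folklore] -/
theorem hasCompactSupport_sq (φ : 𝓓((⊤ : Opens E), ℝ)) :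
    HasCompactSupport (fun y => (φ : E → ℝ) y ^ 2) :=
  φ.hasCompactSupport.comp_left (g := fun t : ℝ => t ^ 2) (by simp)

/-- `γ φ²` is integrable. [folklore] -/
theorem integrable_gaussWeight_mul_sq (φ : 𝓓((⊤ : Opens E), ℝ)) :
    Integrable (fun y => gaussWeight y * (φ : E → ℝ) y ^ 2) :=
  (continuous_gaussWeight.mul (φ.continuous.pow 2)).integrable_of_hasCompactSupport
    (hasCompactSupport_sq φ).mul_left

/-- `γ |∇φ|²` is integrable. [folklore] -/
theorem integrable_gaussWeight_mul_norm_gradient_sq (φ : 𝓓((⊤ : Opens E), ℝ)) :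
    Integrable (fun y => gaussWeight y * ‖gradient (φ : E → ℝ) y‖ ^ 2) := by
  have hφ1 : ContDiff ℝ 1 (φ : E → ℝ) := φ.contDiff.of_le (mod_cast le_top)
  have hgs : HasCompactSupport (fun y => ‖gradient (φ : E → ℝ) y‖ ^ 2) :=
    (hasCompactSupport_gradient φ.hasCompactSupport).comp_left (g := fun v : E => ‖v‖ ^ 2) (by simp)
  exact (continuous_gaussWeight.mul ((continuous_norm.comp (continuous_gradient_of_contDiff hφ1)).pow 2))
    |>.integrable_of_hasCompactSupport hgs.mul_left

/-- `‖φ − χ_R φ‖²_{L²(γ)} = ∫ γ (1 − χ_R)² φ²`. [folklore] -/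
theorem norm_sq_fst_sub_fst_truncTest_eq (φ : 𝓓((⊤ : Opens E), ℝ)) (R : ℝ) :
    ‖((testPair φ).fst : GaussL2 E) - ((testPair (truncTest R φ)).fst : GaussL2 E)‖ ^ 2 =
      ∫ y, gaussWeight y * ((1 - cutoff R y) ^ 2 * (φ : E → ℝ) y ^ 2) := by
  rw [norm_sq_gaussL2]
  refine integral_congr_ae ?_
  filter_upwards [ae_gaussMeasure_iff.1 (Lp.coeFn_sub ((testPair φ).fst : GaussL2 E)
      ((testPair (truncTest R φ)).fst : GaussL2 E)),
    ae_gaussMeasure_iff.1 (coeFn_testPair_fst φ),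
    ae_gaussMeasure_iff.1 (coeFn_testPair_fst (truncTest R φ))] with y h1 h2 h3
  rw [h1, Pi.sub_apply, h2, h3, coe_truncTest]
  ring

/-- **Tail of a truncation**: `‖φ − χ_R φ‖²_{L²(γ)} ≤ R⁻²(4d+16)‖(φ,∇φ)‖²`. [folklore] -/
theorem norm_sq_fst_sub_fst_truncTest_le (φ : 𝓓((⊤ : Opens E), ℝ)) {R : ℝ} (hR : 0 < R) :
    ‖((testPair φ).fst : GaussL2 E) - ((testPair (truncTest R φ)).fst : GaussL2 E)‖ ^ 2 ≤
      R⁻¹ ^ 2 * ((4 * Module.finrank ℝ E + 16) * ‖testPair φ‖ ^ 2) := by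
  refine le_trans ?_ (setIntegral_gaussWeight_mul_sq_le_norm_sq φ hR)
  have hS : MeasurableSet {y : E | R ≤ ‖y‖} := measurableSet_le measurable_const measurable_norm
  have iA := integrable_gaussWeight_mul_sq φ
  have hcχ : Continuous (fun y : E => (1 - cutoff R y) ^ 2) :=
    (continuous_const.sub (contDiff_cutoff (n := 0) R).continuous).pow 2
  have hL2 : HasCompactSupport (fun y => (1 - cutoff R y) ^ 2 * (φ : E → ℝ) y ^ 2) :=
    (hasCompactSupport_sq φ).mul_left
  have iL : Integrable (fun y => gaussWeight y * ((1 - cutoff R y) ^ 2 * (φ : E → ℝ) y ^ 2)) :=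
    (continuous_gaussWeight.mul (hcχ.mul (φ.continuous.pow 2))).integrable_of_hasCompactSupport hL2.mul_left
  have hzero : ∀ y ∉ {y : E | R ≤ ‖y‖}, gaussWeight y * ((1 - cutoff R y) ^ 2 * (φ : E → ℝ) y ^ 2) = 0 := by
    intro y hy
    simp only [Set.mem_setOf_eq, not_le] at hy
    rw [cutoff_eq_one hR hy.le]
    ring
  rw [norm_sq_fst_sub_fst_truncTest_eq φ R, ← setIntegral_eq_integral_of_forall_compl_eq_zero hzero]
  refine setIntegral_mono_on iL.integrableOn iA.integrableOn hS fun y _ => ?_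
  have h0 := cutoff_nonneg R y
  have h1 := cutoff_le_one R y
  have h2 : (1 - cutoff R y) ^ 2 ≤ 1 := by nlinarith
  have h3 : (1 - cutoff R y) ^ 2 * (φ : E → ℝ) y ^ 2 ≤ (φ : E → ℝ) y ^ 2 := by
    have := mul_le_mul_of_nonneg_right h2 (sq_nonneg ((φ : E → ℝ) y))
    linarith
  exact mul_le_mul_of_nonneg_left h3 (gaussWeight_pos y).le

omit [NormedAddCommGroup E] [InnerProductSpace ℝ E] [FiniteDimensional ℝ E] [BorelSpace E] in
/-- `L²`-norms from integrals of squares: `∫ ‖f‖² ≤ K ⇒ ‖f‖_{L²} ≤ √K`. [folklore] -/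
theorem eLpNorm_two_le_ofReal_sqrt {F : Type*} [NormedAddCommGroup F] {μ : Measure E} {f : E → F}
    (hf : MemLp f 2 μ) {K : ℝ} (h : ∫ y, ‖f y‖ ^ 2 ∂μ ≤ K) :
    eLpNorm f 2 μ ≤ ENNReal.ofReal (Real.sqrt K) := by
  rw [hf.eLpNorm_eq_integral_rpow_norm two_ne_zero ENNReal.ofNat_ne_top]
  refine ENNReal.ofReal_le_ofReal ?_
  simp only [ENNReal.toReal_ofNat, Real.rpow_two]
  rw [show (2 : ℝ)⁻¹ = 1 / 2 by norm_num, ← Real.sqrt_eq_rpow]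
  exact Real.sqrt_le_sqrt h

/-- The truncations of a graph-norm-bounded family are bounded in `L²(dy)`:
`∫ (χ_R φ)² dy ≤ e^{R²} ‖(φ,∇φ)‖²`. [folklore] -/
theorem integral_sq_truncTest_le (φ : 𝓓((⊤ : Opens E), ℝ)) {R : ℝ} (hR : 0 < R) :
    ∫ y, ‖(truncTest R φ : E → ℝ) y‖ ^ 2 ≤ Real.exp (R ^ 2) * ‖testPair φ‖ ^ 2 := by
  obtain ⟨hA, -⟩ := integral_sq_le_norm_sq_testPair φ
  refine le_trans ?_ (mul_le_mul_of_nonneg_left hA (Real.exp_pos _).le)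
  rw [← integral_const_mul]
  refine integral_mono_of_nonneg (Eventually.of_forall fun y => sq_nonneg _)
    ((integrable_gaussWeight_mul_sq φ).const_mul _) (Eventually.of_forall fun y => ?_)
  simp only [coe_truncTest, Real.norm_eq_abs, sq_abs]
  have hg := (gaussWeight_pos y).le
  by_cases hy : ‖y‖ ≤ 2 * R
  · have h1 := one_le_exp_mul_gaussWeight (R := R) hy
    have h0 := cutoff_nonneg R y
    have h1' := cutoff_le_one R y
    have hc2 : cutoff R y ^ 2 ≤ 1 := by nlinarith
    have hc : cutoff R y ^ 2 * (φ : E → ℝ) y ^ 2 ≤ (φ : E → ℝ) y ^ 2 := by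
      have := mul_le_mul_of_nonneg_right hc2 (sq_nonneg ((φ : E → ℝ) y))
      linarith
    have k : (φ : E → ℝ) y ^ 2 ≤ Real.exp (R ^ 2) * gaussWeight y * (φ : E → ℝ) y ^ 2 :=
      le_mul_of_one_le_left (sq_nonneg _) h1
    have e1 : (cutoff R y * (φ : E → ℝ) y) ^ 2 = cutoff R y ^ 2 * (φ : E → ℝ) y ^ 2 := by ring
    have e2 : Real.exp (R ^ 2) * (gaussWeight y * (φ : E → ℝ) y ^ 2) =
        Real.exp (R ^ 2) * gaussWeight y * (φ : E → ℝ) y ^ 2 := by ring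
    rw [e1, e2]
    linarith
  · rw [cutoff_eq_zero hR (not_le.mp hy).le]
    have := mul_nonneg (Real.exp_pos (R ^ 2)).le (mul_nonneg hg (sq_nonneg ((φ : E → ℝ) y)))
    simpa using this

/-- The derivatives of the truncations are bounded in `L²(dy)`:
`∫ ‖D(χ_R φ)‖² dy ≤ 2 e^{R²} (1 + (C/R)²) ‖(φ,∇φ)‖²`. [folklore] -/
theorem integral_sq_fderiv_truncTest_le (φ : 𝓓((⊤ : Opens E), ℝ)) {R C : ℝ} (hR : 0 < R)
    (hC : ∀ x : E, ‖fderiv ℝ (cutoff R) x‖ ≤ C / R) :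
    ∫ y, ‖fderiv ℝ (truncTest R φ : E → ℝ) y‖ ^ 2 ≤
      2 * Real.exp (R ^ 2) * (1 + (C / R) ^ 2) * ‖testPair φ‖ ^ 2 := by
  obtain ⟨hA, hB⟩ := integral_sq_le_norm_sq_testPair φ
  have hφ1 : ContDiff ℝ 1 (φ : E → ℝ) := φ.contDiff.of_le (mod_cast le_top)
  -- pointwise bound
  have hpt : ∀ y, ‖fderiv ℝ (truncTest R φ : E → ℝ) y‖ ^ 2 ≤
      2 * Real.exp (R ^ 2) * (gaussWeight y * ‖gradient (φ : E → ℝ) y‖ ^ 2) +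
        2 * Real.exp (R ^ 2) * (C / R) ^ 2 * (gaussWeight y * (φ : E → ℝ) y ^ 2) := by
    intro y
    have hg := (gaussWeight_pos y).le
    by_cases hy : ‖y‖ ≤ 2 * R
    · have h1 := one_le_exp_mul_gaussWeight (R := R) hy
      have hL := SobolevWholeSpace.norm_fderiv_cutoff_smul_le (u := (φ : E → ℝ)) hφ1 hC y
      have e : (fun z => cutoff R z • (φ : E → ℝ) z) = (truncTest R φ : E → ℝ) := by
        funext z; simp [smul_eq_mul]
      rw [e, ← norm_gradient_eq_norm_fderiv (φ : E → ℝ) y] at hL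
      set a := ‖gradient (φ : E → ℝ) y‖ with ha
      set p := (φ : E → ℝ) y with hp
      have hpn : ‖p‖ ^ 2 = p ^ 2 := by rw [Real.norm_eq_abs, sq_abs]
      have hb : 0 ≤ C / R * ‖p‖ := by
        have := (norm_nonneg _).trans (hC y)
        positivity
      have h2 : ‖fderiv ℝ (truncTest R φ : E → ℝ) y‖ ^ 2 ≤ (a + C / R * ‖p‖) ^ 2 :=
        pow_le_pow_left₀ (norm_nonneg _) hL 2
      have h3 : (a + C / R * ‖p‖) ^ 2 ≤ 2 * a ^ 2 + 2 * (C / R) ^ 2 * p ^ 2 := by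
        rw [← hpn]; nlinarith [sq_nonneg (a - C / R * ‖p‖)]
      have k1 : a ^ 2 ≤ Real.exp (R ^ 2) * gaussWeight y * a ^ 2 :=
        le_mul_of_one_le_left (sq_nonneg _) h1
      have k2 : p ^ 2 ≤ Real.exp (R ^ 2) * gaussWeight y * p ^ 2 :=
        le_mul_of_one_le_left (sq_nonneg _) h1
      have k3 := mul_le_mul_of_nonneg_left k2 (sq_nonneg (C / R))
      nlinarith
    · rw [fderiv_truncTest_eq_zero hR φ (not_le.mp hy), norm_zero]
      have := add_nonneg
        (mul_nonneg (by positivity : (0:ℝ) ≤ 2 * Real.exp (R ^ 2))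
          (mul_nonneg hg (sq_nonneg ‖gradient (φ : E → ℝ) y‖)))
        (mul_nonneg (by positivity : (0:ℝ) ≤ 2 * Real.exp (R ^ 2) * (C / R) ^ 2)
          (mul_nonneg hg (sq_nonneg ((φ : E → ℝ) y))))
      simpa using this
  -- integrate
  have iA := integrable_gaussWeight_mul_sq φ
  have iB := integrable_gaussWeight_mul_norm_gradient_sq φ
  have hm := integral_mono_of_nonneg (μ := (volume : Measure E))
    (f := fun y => ‖fderiv ℝ (truncTest R φ : E → ℝ) y‖ ^ 2)
    (g := fun y => 2 * Real.exp (R ^ 2) * (gaussWeight y * ‖gradient (φ : E → ℝ) y‖ ^ 2) +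
        2 * Real.exp (R ^ 2) * (C / R) ^ 2 * (gaussWeight y * (φ : E → ℝ) y ^ 2))
    (Eventually.of_forall fun y => sq_nonneg _) ((iB.const_mul _).add (iA.const_mul _))
    (Eventually.of_forall hpt)
  rw [integral_add (iB.const_mul _) (iA.const_mul _), integral_const_mul, integral_const_mul] at hm
  have he : 0 ≤ Real.exp (R ^ 2) := (Real.exp_pos _).le
  have hc2 : 0 ≤ (C / R) ^ 2 := sq_nonneg _
  nlinarith [mul_le_mul_of_nonneg_left hB (by positivity : (0:ℝ) ≤ 2 * Real.exp (R ^ 2)),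
    mul_le_mul_of_nonneg_left hA (by positivity : (0:ℝ) ≤ 2 * Real.exp (R ^ 2) * (C / R) ^ 2)]

/-! ### Rellich on a ball, transported to `L²(γ)` -/

/-- **Local compactness** (Rellich–Kondrachov on the ball of radius `2R`, the tree's
`Literature.Analysis.FunctionSpaces.exists_subseq_tendsto_eLpNorm_of_contDiff`): for a sequence of test functions bounded by `2`
in graph norm, the truncations `χ_R φ_n` have a subsequence converging in `L²(γ)`. [cite: Evans2010, §5.7 Theorem 1] -/
theorem exists_subseq_tendsto_fst_truncTest {R : ℝ} (hR : 0 < R) (φ : ℕ → 𝓓((⊤ : Opens E), ℝ))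
    (hφ : ∀ n, ‖testPair (φ n)‖ ≤ 2) :
    ∃ (b : GaussL2 E) (ψ : ℕ → ℕ), StrictMono ψ ∧
      Tendsto (fun n => ((testPair (truncTest R (φ (ψ n)))).fst : GaussL2 E)) atTop (𝓝 b) := by
  obtain ⟨C, hC0, hC⟩ := exists_norm_fderiv_cutoff_le (E := E)
  set u : ℕ → E → ℝ := fun n => (truncTest R (φ n) : E → ℝ) with hu
  have hu1 : ∀ n, ContDiff ℝ 1 (u n) := fun n =>
    (truncTest R (φ n)).contDiff.of_le (mod_cast le_top)
  have huK : ∀ n, tsupport (u n) ⊆ Metric.closedBall (0 : E) (2 * R) := fun n =>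
    tsupport_truncTest_subset hR (φ n)
  have hmem : ∀ n, MemLp (u n) 2 (volume : Measure E) := fun n =>
    (truncTest R (φ n)).continuous.memLp_of_hasCompactSupport (truncTest R (φ n)).hasCompactSupport
  have hmemD : ∀ n, MemLp (fderiv ℝ (u n)) 2 (volume : Measure E) := fun n =>
    ((truncTest R (φ n)).contDiff.continuous_fderiv (by simp)).memLp_of_hasCompactSupport
      ((truncTest R (φ n)).hasCompactSupport.fderiv (𝕜 := ℝ))
  have hsq : ∀ n, ‖testPair (φ n)‖ ^ 2 ≤ 4 := fun n => by nlinarith [hφ n, norm_nonneg (testPair (φ n))]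
  set A : ℝ≥0∞ := ENNReal.ofReal (Real.sqrt (Real.exp (R ^ 2) * 4)) with hAdef
  set B : ℝ≥0∞ := ENNReal.ofReal (Real.sqrt (2 * Real.exp (R ^ 2) * (1 + (C / R) ^ 2) * 4)) with hBdef
  have hA : ∀ n, eLpNorm (u n) 2 (volume : Measure E) ≤ A := fun n => by
    refine eLpNorm_two_le_ofReal_sqrt (hmem n) ((integral_sq_truncTest_le (φ n) hR).trans ?_)
    exact mul_le_mul_of_nonneg_left (hsq n) (Real.exp_pos _).le
  have hB : ∀ n, eLpNorm (fderiv ℝ (u n)) 2 (volume : Measure E) ≤ B := fun n => by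
    refine eLpNorm_two_le_ofReal_sqrt (hmemD n) ((integral_sq_fderiv_truncTest_le (φ n) hR (hC R hR)).trans ?_)
    exact mul_le_mul_of_nonneg_left (hsq n) (by positivity)
  obtain ⟨f, ψ, hψ, hf, hlim⟩ :=
    FunctionSpaces.exists_subseq_tendsto_eLpNorm_of_contDiff (volume : Measure E) (p := 2) (by norm_num)
      (isCompact_closedBall (0 : E) (2 * R)) u hu1 huK ENNReal.ofReal_ne_top ENNReal.ofReal_ne_top hA hB
  have hfγ : MemLp f 2 (gaussMeasure (E := E)) := hf.mono_measure gaussMeasure_le_volume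
  refine ⟨hfγ.toLp f, ψ, hψ, ?_⟩
  rw [tendsto_iff_dist_tendsto_zero]
  have hle : ∀ n, dist ((testPair (truncTest R (φ (ψ n)))).fst : GaussL2 E) (hfγ.toLp f) ≤
      (eLpNorm (u (ψ n) - f) 2 (volume : Measure E)).toReal := by
    intro n
    rw [Lp.dist_def]
    have e : eLpNorm ((((testPair (truncTest R (φ (ψ n)))).fst : GaussL2 E) : E → ℝ) - ((hfγ.toLp f : GaussL2 E) : E → ℝ)) 2 gaussMeasure =
        eLpNorm (u (ψ n) - f) 2 (gaussMeasure (E := E)) :=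
      eLpNorm_congr_ae ((coeFn_testPair_fst _).sub hfγ.coeFn_toLp)
    rw [e]
    exact ENNReal.toReal_mono (((hmem _).sub hf).eLpNorm_ne_top)
      (eLpNorm_mono_measure _ gaussMeasure_le_volume)
  refine squeeze_zero (fun n => dist_nonneg) hle ?_
  have := (ENNReal.tendsto_toReal ENNReal.zero_ne_top).comp hlim
  simpa only [ENNReal.toReal_zero, Function.comp_def] using this

/-- The truncations at radius `R` of the graph pairs of norm `≤ 2`. [folklore] -/
def truncSet (R : ℝ) : Set (GaussL2 E) :=
  {a | ∃ φ : 𝓓((⊤ : Opens E), ℝ), ‖testPair φ‖ ≤ 2 ∧ a = (testPair (truncTest R φ)).fst}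

/-- The closure of `truncSet R` is sequentially compact in `L²(γ)`. [folklore] -/
theorem isSeqCompact_closure_truncSet {R : ℝ} (hR : 0 < R) :
    IsSeqCompact (closure (truncSet (E := E) R)) := by
  intro x hx
  have happrox : ∀ n : ℕ, ∃ φ : 𝓓((⊤ : Opens E), ℝ), ‖testPair φ‖ ≤ 2 ∧
      dist (x n) ((testPair (truncTest R φ)).fst) < 1 / ((n : ℝ) + 1) := by
    intro n
    obtain ⟨a, ha, hd⟩ := Metric.mem_closure_iff.1 (hx n) (1 / ((n : ℝ) + 1)) (by positivity)
    obtain ⟨φ, hφ, rfl⟩ := ha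
    exact ⟨φ, hφ, hd⟩
  choose φ hφb hφd using happrox
  obtain ⟨b, ψ, hψ, hb⟩ := exists_subseq_tendsto_fst_truncTest hR φ hφb
  refine ⟨b, ?_, ψ, hψ, ?_⟩
  · exact mem_closure_of_tendsto hb (Eventually.of_forall fun n => ⟨φ (ψ n), hφb _, rfl⟩)
  · rw [tendsto_iff_dist_tendsto_zero] at hb ⊢
    have h1 : Tendsto (fun n => dist (x (ψ n)) ((testPair (truncTest R (φ (ψ n)))).fst)) atTop (𝓝 0) := by
      have hψt : Tendsto (fun n : ℕ => ((ψ n : ℕ) : ℝ) + 1) atTop atTop :=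
        (tendsto_natCast_atTop_atTop.comp hψ.tendsto_atTop).atTop_add tendsto_const_nhds
      have h0 : Tendsto (fun n : ℕ => 1 / (((ψ n : ℕ) : ℝ) + 1)) atTop (𝓝 0) :=
        tendsto_const_nhds.div_atTop hψt
      exact squeeze_zero (fun _ => dist_nonneg) (fun n => (hφd (ψ n)).le) h0
    have h2 := h1.add hb
    rw [add_zero] at h2
    exact squeeze_zero (fun _ => dist_nonneg) (fun n => dist_triangle _ _ _) h2

/-- `truncSet R` is totally bounded in `L²(γ)`. [folklore] -/
theorem totallyBounded_truncSet {R : ℝ} (hR : 0 < R) : TotallyBounded (truncSet (E := E) R) :=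
  (isSeqCompact_closure_truncSet hR).totallyBounded.subset subset_closure

/-! ### The compact embedding -/

/-- The first projection `V → L²(γ)`, `(f, G) ↦ f`, as a continuous linear map. [folklore] -/
def gaussFstL : gaussGraph (E := E) →L[ℝ] GaussL2 E :=
  (WithLp.fstL 2 ℝ (GaussL2 E) (GaussL2Vec E)).comp (gaussGraph (E := E)).subtypeL

/-- Unfolding `gaussFstL`. [folklore] -/
@[simp] theorem gaussFstL_apply (x : gaussGraph (E := E)) : gaussFstL x = (x : GaussProd E).fst := rfl

/-- The image of the unit ball of `V` in `L²(γ)` is totally bounded (uniform Gaussian tails + local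
Rellich compactness). [folklore] -/
theorem totallyBounded_image_gaussFstL :
    TotallyBounded (gaussFstL '' Metric.closedBall (0 : gaussGraph (E := E)) 1) := by
  rw [Metric.totallyBounded_iff]
  intro ε hε
  set d4 : ℝ := 4 * Module.finrank ℝ E + 16 with hd4
  have hd4pos : 0 < d4 := by positivity
  -- choice of the radius
  set R : ℝ := 8 * Real.sqrt d4 / ε + 1 with hRdef
  have hRpos : 0 < R := by positivity
  have htail : R⁻¹ ^ 2 * (d4 * 4) ≤ (ε / 4) ^ 2 := by
    have hsq : Real.sqrt d4 ^ 2 = d4 := Real.sq_sqrt hd4pos.le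
    have hR1 : 8 * Real.sqrt d4 / ε ≤ R := by linarith
    have hs0 : 0 < Real.sqrt d4 := Real.sqrt_pos.2 hd4pos
    -- `R⁻¹ ≤ ε / (8 √d4)`
    have hinv : R⁻¹ ≤ ε / (8 * Real.sqrt d4) := by
      rw [inv_le_comm₀ hRpos (by positivity), inv_div]
      exact hR1
    have hinv0 : 0 ≤ R⁻¹ := by positivity
    calc R⁻¹ ^ 2 * (d4 * 4) ≤ (ε / (8 * Real.sqrt d4)) ^ 2 * (d4 * 4) :=
          mul_le_mul_of_nonneg_right (pow_le_pow_left₀ hinv0 hinv 2) (by positivity)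
      _ = (ε / 4) ^ 2 := by
          field_simp
          nlinarith [hsq]
  obtain ⟨t, tfin, hcov⟩ := Metric.totallyBounded_iff.1 (totallyBounded_truncSet (E := E) hRpos) (ε / 4)
    (by positivity)
  refine ⟨t, tfin, ?_⟩
  rintro _ ⟨x, hx, rfl⟩
  have hx1 : ‖(x : GaussProd E)‖ ≤ 1 := by
    simpa [Metric.mem_closedBall, dist_zero_right] using hx
  obtain ⟨φ, hφ⟩ := exists_testPair_dist_lt x.2 (ε := min (ε / 4) 1) (by positivity)
  have hφε : dist (testPair φ) (x : GaussProd E) < ε / 4 := hφ.trans_le (min_le_left _ _)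
  have hφ1 : dist (testPair φ) (x : GaussProd E) < 1 := hφ.trans_le (min_le_right _ _)
  have hφ2 : ‖testPair φ‖ ≤ 2 := by
    have := norm_le_norm_add_norm_sub' (testPair φ) (x : GaussProd E)
    rw [← dist_eq_norm] at this
    linarith
  have hmem : (testPair (truncTest R φ)).fst ∈ truncSet (E := E) R := ⟨φ, hφ2, rfl⟩
  obtain ⟨y, hy, hyd⟩ : ∃ y ∈ t, dist ((testPair (truncTest R φ)).fst : GaussL2 E) y < ε / 4 := by
    simpa only [Set.mem_iUnion, Metric.mem_ball, exists_prop] using hcov hmem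
  refine Set.mem_iUnion₂.2 ⟨y, hy, ?_⟩
  rw [Metric.mem_ball]
  -- the three distances
  have d1 : dist (gaussFstL x) ((testPair φ).fst : GaussL2 E) < ε / 4 := by
    rw [gaussFstL_apply, dist_eq_norm, ← WithLp.sub_fst]
    refine lt_of_le_of_lt (WithLp.norm_fst_le (GaussL2 E) ((x : GaussProd E) - testPair φ)) ?_
    rwa [← dist_eq_norm, dist_comm]
  have d2 : dist ((testPair φ).fst : GaussL2 E) ((testPair (truncTest R φ)).fst : GaussL2 E) ≤ ε / 4 := by
    rw [dist_eq_norm]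
    have h := norm_sq_fst_sub_fst_truncTest_le φ hRpos
    have h' : ‖((testPair φ).fst : GaussL2 E) - ((testPair (truncTest R φ)).fst : GaussL2 E)‖ ^ 2 ≤ (ε / 4) ^ 2 := by
      refine h.trans (le_trans ?_ htail)
      have : d4 * ‖testPair φ‖ ^ 2 ≤ d4 * 4 := by
        refine mul_le_mul_of_nonneg_left ?_ hd4pos.le
        nlinarith [norm_nonneg (testPair φ)]
      exact mul_le_mul_of_nonneg_left this (by positivity)
    exact (pow_le_pow_iff_left₀ (norm_nonneg _) (by positivity) two_ne_zero).1 h'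
  calc dist (gaussFstL x) y
      ≤ dist (gaussFstL x) ((testPair φ).fst : GaussL2 E) +
          dist ((testPair φ).fst : GaussL2 E) ((testPair (truncTest R φ)).fst : GaussL2 E) +
          dist ((testPair (truncTest R φ)).fst : GaussL2 E) y := dist_triangle4 _ _ _ _
    _ < ε := by linarith

/-- **Compactness of `V ↪ L²(γ)`**: the first projection `gaussGraph → L²(γ)` is a compact operator
(Gaussian tails from the weighted Hardy inequality, Rellich–Kondrachov on balls). [folklore] -/
theorem isCompactOperator_gaussFstL : IsCompactOperator (gaussFstL (E := E)) := by
  set S := gaussFstL '' Metric.closedBall (0 : gaussGraph (E := E)) 1 with hS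
  have hK : IsCompact (closure S) :=
    (totallyBounded_image_gaussFstL (E := E)).closure.isCompact_of_isClosed isClosed_closure
  refine ⟨closure S, hK, ?_⟩
  refine Filter.mem_of_superset (Metric.closedBall_mem_nhds (0 : gaussGraph (E := E)) one_pos) fun x hx => ?_
  exact subset_closure ⟨x, hx, rfl⟩

end Compactness


/-! ## F3: existence of a nonzero weak solution (Lax–Milgram + Fredholm) -/

section Existence

variable {U : E → E} {C₀ : ℝ}

/-! ### Multiplication operators on `L²(γ)` -/

/-- `⟪U, G⟫ ∈ L²(γ)` for `G ∈ L²(γ; E)` and bounded continuous `U`. [folklore] -/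
theorem memLp_inner_apply (hUc : Continuous U) (hb : ∀ y, ‖U y‖ ≤ C₀) (G : GaussL2Vec E) :
    MemLp (fun y => ⟪U y, (G : E → E) y⟫) 2 (gaussMeasure (E := E)) := by
  refine (Lp.memLp G).of_le_mul (c := C₀)
    ((hUc.aestronglyMeasurable.mono_ac gaussMeasure_absolutelyContinuous).inner
      (Lp.memLp G).aestronglyMeasurable) (Eventually.of_forall fun y => ?_)
  exact (norm_inner_le_norm _ _).trans (mul_le_mul_of_nonneg_right (hb y) (norm_nonneg _))

/-- **The multiplication operator `G ↦ ⟪U, G⟫`**, `L²(γ; E) → L²(γ)`. [folklore] -/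
def mulInnerL (hUc : Continuous U) (hb : ∀ y, ‖U y‖ ≤ C₀) : GaussL2Vec E →L[ℝ] GaussL2 E :=
  LinearMap.mkContinuous
    { toFun := fun G => (memLp_inner_apply hUc hb G).toLp _
      map_add' := fun G G' => by
        rw [← MemLp.toLp_add (memLp_inner_apply hUc hb G) (memLp_inner_apply hUc hb G')]
        refine MemLp.toLp_congr _ _ ?_
        filter_upwards [Lp.coeFn_add G G'] with y hy
        simp only [hy, Pi.add_apply, inner_add_right]
      map_smul' := fun c G => by
        rw [RingHom.id_apply, ← MemLp.toLp_const_smul c (memLp_inner_apply hUc hb G)]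
        refine MemLp.toLp_congr _ _ ?_
        filter_upwards [Lp.coeFn_smul c G] with y hy
        simp only [hy, Pi.smul_apply, inner_smul_right, smul_eq_mul] }
    C₀ (fun G => by
      refine Lp.norm_le_mul_norm_of_ae_le_mul ?_
      filter_upwards [(memLp_inner_apply hUc hb G).coeFn_toLp] with y hy
      simp only [LinearMap.coe_mk, AddHom.coe_mk] at hy ⊢
      rw [hy]
      exact (norm_inner_le_norm _ _).trans (mul_le_mul_of_nonneg_right (hb y) (norm_nonneg _)))

/-- The multiplication operator acts pointwise a.e. [folklore] -/
theorem coeFn_mulInnerL (hUc : Continuous U) (hb : ∀ y, ‖U y‖ ≤ C₀) (G : GaussL2Vec E) :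
    ((mulInnerL hUc hb G : GaussL2 E) : E → ℝ) =ᵐ[gaussMeasure] fun y => ⟪U y, (G : E → E) y⟫ :=
  (memLp_inner_apply hUc hb G).coeFn_toLp

/-- `‖⟪U, G⟫‖ ≤ C₀ ‖G‖`. [folklore] -/
theorem norm_mulInnerL_le (hUc : Continuous U) (hb : ∀ y, ‖U y‖ ≤ C₀) (G : GaussL2Vec E) :
    ‖mulInnerL hUc hb G‖ ≤ C₀ * ‖G‖ := by
  refine Lp.norm_le_mul_norm_of_ae_le_mul ?_
  filter_upwards [coeFn_mulInnerL hUc hb G] with y hy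
  rw [hy]
  exact (norm_inner_le_norm _ _).trans (mul_le_mul_of_nonneg_right (hb y) (norm_nonneg _))

/-- `½⟪U, y⟫ f ∈ L²(γ)` for `f ∈ L²(γ)` when `⟪U, y⟫` is bounded. [folklore] -/
theorem memLp_pot_mul (hUc : Continuous U) (hby : ∀ y, |⟪U y, y⟫| ≤ C₀) (f : GaussL2 E) :
    MemLp (fun y => ⟪U y, y⟫ / 2 * (f : E → ℝ) y) 2 (gaussMeasure (E := E)) := by
  refine (Lp.memLp f).of_le_mul (c := C₀ / 2)
    ((((hUc.inner continuous_id).div_const 2).aestronglyMeasurable.mono_ac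
      gaussMeasure_absolutelyContinuous).mul (Lp.memLp f).aestronglyMeasurable)
    (Eventually.of_forall fun y => ?_)
  rw [norm_mul, Real.norm_eq_abs, abs_div, abs_two]
  exact mul_le_mul_of_nonneg_right (by linarith [hby y]) (norm_nonneg _)

/-- **The potential multiplication operator `f ↦ ½⟪U, y⟫ f`** on `L²(γ)`. [folklore] -/
def mulPotL (hUc : Continuous U) (hby : ∀ y, |⟪U y, y⟫| ≤ C₀) : GaussL2 E →L[ℝ] GaussL2 E :=
  LinearMap.mkContinuous
    { toFun := fun f => (memLp_pot_mul hUc hby f).toLp _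
      map_add' := fun f f' => by
        rw [← MemLp.toLp_add (memLp_pot_mul hUc hby f) (memLp_pot_mul hUc hby f')]
        refine MemLp.toLp_congr _ _ ?_
        filter_upwards [Lp.coeFn_add f f'] with y hy
        simp only [hy, Pi.add_apply]
        ring
      map_smul' := fun c f => by
        rw [RingHom.id_apply, ← MemLp.toLp_const_smul c (memLp_pot_mul hUc hby f)]
        refine MemLp.toLp_congr _ _ ?_
        filter_upwards [Lp.coeFn_smul c f] with y hy
        simp only [hy, Pi.smul_apply, smul_eq_mul]
        ring }
    (C₀ / 2) (fun f => by
      refine Lp.norm_le_mul_norm_of_ae_le_mul ?_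
      filter_upwards [(memLp_pot_mul hUc hby f).coeFn_toLp] with y hy
      simp only [LinearMap.coe_mk, AddHom.coe_mk] at hy ⊢
      rw [hy, norm_mul, Real.norm_eq_abs, abs_div, abs_two]
      exact mul_le_mul_of_nonneg_right (by linarith [hby y]) (norm_nonneg _))

/-- The potential operator acts pointwise a.e. [folklore] -/
theorem coeFn_mulPotL (hUc : Continuous U) (hby : ∀ y, |⟪U y, y⟫| ≤ C₀) (f : GaussL2 E) :
    ((mulPotL hUc hby f : GaussL2 E) : E → ℝ) =ᵐ[gaussMeasure] fun y => ⟪U y, y⟫ / 2 * (f : E → ℝ) y :=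
  (memLp_pot_mul hUc hby f).coeFn_toLp

/-- `‖½⟪U,y⟫ f‖ ≤ (C₀/2) ‖f‖`. [folklore] -/
theorem norm_mulPotL_le (hUc : Continuous U) (hby : ∀ y, |⟪U y, y⟫| ≤ C₀) (f : GaussL2 E) :
    ‖mulPotL hUc hby f‖ ≤ C₀ / 2 * ‖f‖ := by
  refine Lp.norm_le_mul_norm_of_ae_le_mul ?_
  filter_upwards [coeFn_mulPotL hUc hby f] with y hy
  rw [hy, norm_mul, Real.norm_eq_abs, abs_div, abs_two]
  exact mul_le_mul_of_nonneg_right (by linarith [hby y]) (norm_nonneg _)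

/-! ### The shifted bilinear form and its coercivity -/

/-- The coercivity shift `μ₀ = C₀² + C₀ + 1`. [folklore] -/
def shiftConst (C₀ : ℝ) : ℝ := C₀ ^ 2 + C₀ + 1

omit [NormedAddCommGroup E] [InnerProductSpace ℝ E] [FiniteDimensional ℝ E] [MeasurableSpace E]
  [BorelSpace E] in
/-- `μ₀ > 0`. [folklore] -/
theorem shiftConst_pos (C₀ : ℝ) : 0 < shiftConst C₀ := by
  unfold shiftConst; nlinarith [sq_nonneg (C₀ + 1 / 2)]

/-- The operator `(f, G) ↦ (μ₀ f + ½⟪U,y⟫ f − ⟪U, G⟫, G)` representing the shifted form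
`a_{μ₀}((f,G),(f',G')) = ∫γ⟪G,G'⟫ − ∫γ⟪U,G⟫f' + ∫γ ½⟪U,y⟫ f f' + μ₀ ∫γ f f'` through the inner
product of `L²(γ) × L²(γ; E)`. [folklore] -/
def formOp (hUc : Continuous U) (hb : ∀ y, ‖U y‖ ≤ C₀) (hby : ∀ y, |⟪U y, y⟫| ≤ C₀) :
    GaussProd E →L[ℝ] GaussProd E :=
  ((WithLp.prodContinuousLinearEquiv 2 ℝ (GaussL2 E) (GaussL2Vec E)).symm :
      (GaussL2 E × GaussL2Vec E) →L[ℝ] GaussProd E).comp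
    (ContinuousLinearMap.prod
      (shiftConst C₀ • WithLp.fstL 2 ℝ (GaussL2 E) (GaussL2Vec E) +
        (mulPotL hUc hby).comp (WithLp.fstL 2 ℝ (GaussL2 E) (GaussL2Vec E)) -
        (mulInnerL hUc hb).comp (WithLp.sndL 2 ℝ (GaussL2 E) (GaussL2Vec E)))
      (WithLp.sndL 2 ℝ (GaussL2 E) (GaussL2Vec E)))

/-- First component of `formOp`. [folklore] -/
theorem formOp_fst (hUc : Continuous U) (hb : ∀ y, ‖U y‖ ≤ C₀) (hby : ∀ y, |⟪U y, y⟫| ≤ C₀)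
    (x : GaussProd E) :
    (formOp hUc hb hby x).fst = shiftConst C₀ • x.fst + mulPotL hUc hby x.fst - mulInnerL hUc hb x.snd :=
  rfl

/-- Second component of `formOp`. [folklore] -/
theorem formOp_snd (hUc : Continuous U) (hb : ∀ y, ‖U y‖ ≤ C₀) (hby : ∀ y, |⟪U y, y⟫| ≤ C₀)
    (x : GaussProd E) : (formOp hUc hb hby x).snd = x.snd :=
  rfl

/-- **The shifted bilinear form `a_{μ₀}`** on `L²(γ) × L²(γ; E)` as a continuous bilinear map. [folklore] -/
def formBilin (hUc : Continuous U) (hb : ∀ y, ‖U y‖ ≤ C₀) (hby : ∀ y, |⟪U y, y⟫| ≤ C₀) :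
    GaussProd E →L[ℝ] GaussProd E →L[ℝ] ℝ :=
  (innerSL ℝ : GaussProd E →L[ℝ] GaussProd E →L[ℝ] ℝ).comp (formOp hUc hb hby)

/-- `a_{μ₀}(x, x') = ⟪formOp x, x'⟫`. [folklore] -/
theorem formBilin_apply (hUc : Continuous U) (hb : ∀ y, ‖U y‖ ≤ C₀) (hby : ∀ y, |⟪U y, y⟫| ≤ C₀)
    (x x' : GaussProd E) : formBilin hUc hb hby x x' = ⟪formOp hUc hb hby x, x'⟫ := rfl

/-- `a_{μ₀}(x, x')` written out. [folklore] -/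
theorem formBilin_apply' (hUc : Continuous U) (hb : ∀ y, ‖U y‖ ≤ C₀) (hby : ∀ y, |⟪U y, y⟫| ≤ C₀)
    (x x' : GaussProd E) :
    formBilin hUc hb hby x x' = shiftConst C₀ * ⟪x.fst, x'.fst⟫ + ⟪mulPotL hUc hby x.fst, x'.fst⟫ -
      ⟪mulInnerL hUc hb x.snd, x'.fst⟫ + ⟪x.snd, x'.snd⟫ := by
  rw [formBilin_apply, WithLp.prod_inner_apply]
  change ⟪(formOp hUc hb hby x).fst, x'.fst⟫ + ⟪(formOp hUc hb hby x).snd, x'.snd⟫ = _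
  rw [formOp_fst, formOp_snd, inner_sub_left, inner_add_left, real_inner_smul_left]

/-- **Coercivity**: `a_{μ₀}(x, x) ≥ ½‖x‖²` on all of `L²(γ) × L²(γ; E)` (for `C₀ ≥ 0`). [folklore] -/
theorem half_norm_sq_le_formBilin (hUc : Continuous U) (hb : ∀ y, ‖U y‖ ≤ C₀)
    (hby : ∀ y, |⟪U y, y⟫| ≤ C₀) (hC₀ : 0 ≤ C₀) (x : GaussProd E) :
    (1 / 2 : ℝ) * ‖x‖ ^ 2 ≤ formBilin hUc hb hby x x := by
  rw [formBilin_apply', norm_sq_gaussProd, real_inner_self_eq_norm_sq, real_inner_self_eq_norm_sq]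
  have h1 : -(C₀ / 2 * ‖x.fst‖ * ‖x.fst‖) ≤ ⟪mulPotL hUc hby x.fst, x.fst⟫ := by
    have := abs_real_inner_le_norm (mulPotL hUc hby x.fst) x.fst
    have hn := norm_mulPotL_le hUc hby x.fst
    have := neg_abs_le ⟪mulPotL hUc hby x.fst, x.fst⟫
    nlinarith [norm_nonneg x.fst]
  have h2 : ⟪mulInnerL hUc hb x.snd, x.fst⟫ ≤ C₀ * ‖x.snd‖ * ‖x.fst‖ := by
    have := real_inner_le_norm (mulInnerL hUc hb x.snd) x.fst
    have hn := norm_mulInnerL_le hUc hb x.snd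
    nlinarith [norm_nonneg x.fst]
  unfold shiftConst
  nlinarith [sq_nonneg (‖x.snd‖ - C₀ * ‖x.fst‖), norm_nonneg x.fst, norm_nonneg x.snd,
    mul_nonneg hC₀ (mul_nonneg (norm_nonneg x.fst) (norm_nonneg x.fst))]

/-- The form restricted to `V`. [folklore] -/
def formBilinV (hUc : Continuous U) (hb : ∀ y, ‖U y‖ ≤ C₀) (hby : ∀ y, |⟪U y, y⟫| ≤ C₀) :
    gaussGraph (E := E) →L[ℝ] gaussGraph (E := E) →L[ℝ] ℝ :=
  (((formBilin hUc hb hby).comp (gaussGraph (E := E)).subtypeL).flip.comp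
    (gaussGraph (E := E)).subtypeL).flip

/-- Unfolding the restricted form. [folklore] -/
@[simp] theorem formBilinV_apply (hUc : Continuous U) (hb : ∀ y, ‖U y‖ ≤ C₀) (hby : ∀ y, |⟪U y, y⟫| ≤ C₀)
    (v v' : gaussGraph (E := E)) :
    formBilinV hUc hb hby v v' = formBilin hUc hb hby (v : GaussProd E) (v' : GaussProd E) := rfl

/-- **The restricted form is coercive** (Lax–Milgram hypothesis). [folklore] -/
theorem isCoercive_formBilinV (hUc : Continuous U) (hb : ∀ y, ‖U y‖ ≤ C₀)
    (hby : ∀ y, |⟪U y, y⟫| ≤ C₀) (hC₀ : 0 ≤ C₀) : IsCoercive (formBilinV (E := E) hUc hb hby) := by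
  refine ⟨1 / 2, by norm_num, fun v => ?_⟩
  have h := half_norm_sq_le_formBilin hUc hb hby hC₀ (v : GaussProd E)
  rw [formBilinV_apply, Submodule.coe_norm]
  nlinarith

/-! ### The solution operator and its compactness -/

/-- The solution operator `h ↦ v_h ∈ V` of `a_{μ₀}(v_h, ·) = ⟪h, (·)₁⟫_{L²(γ)}` (Lax–Milgram and
the Riesz representation of `v' ↦ ⟪h, v'₁⟫` through the adjoint of the projection). [folklore] -/
def solOpV (hUc : Continuous U) (hb : ∀ y, ‖U y‖ ≤ C₀) (hby : ∀ y, |⟪U y, y⟫| ≤ C₀) (hC₀ : 0 ≤ C₀) :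
    GaussL2 E →L[ℝ] gaussGraph (E := E) :=
  ((isCoercive_formBilinV hUc hb hby hC₀).continuousLinearEquivOfBilin.symm :
      gaussGraph (E := E) →L[ℝ] gaussGraph (E := E)).comp
    (ContinuousLinearMap.adjoint (gaussFstL (E := E)))

/-- **The weak equation solved by `solOpV h`**: `a_{μ₀}(v_h, v') = ⟪h, v'₁⟫` for all `v' ∈ V`. [folklore] -/
theorem formBilinV_solOpV (hUc : Continuous U) (hb : ∀ y, ‖U y‖ ≤ C₀) (hby : ∀ y, |⟪U y, y⟫| ≤ C₀)
    (hC₀ : 0 ≤ C₀) (h : GaussL2 E) (v' : gaussGraph (E := E)) :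
    formBilinV hUc hb hby (solOpV hUc hb hby hC₀ h) v' = ⟪h, gaussFstL v'⟫ := by
  rw [solOpV, ContinuousLinearMap.comp_apply, ContinuousLinearEquiv.coe_coe,
    ← IsCoercive.continuousLinearEquivOfBilin_apply (isCoercive_formBilinV hUc hb hby hC₀),
    ContinuousLinearEquiv.apply_symm_apply, ContinuousLinearMap.adjoint_inner_left]

/-- The solution operator followed by the projection, `K : L²(γ) → L²(γ)`. [folklore] -/
def solOp (hUc : Continuous U) (hb : ∀ y, ‖U y‖ ≤ C₀) (hby : ∀ y, |⟪U y, y⟫| ≤ C₀) (hC₀ : 0 ≤ C₀) :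
    GaussL2 E →L[ℝ] GaussL2 E :=
  (gaussFstL (E := E)).comp (solOpV hUc hb hby hC₀)

/-- Unfolding `K`. [folklore] -/
theorem solOp_apply (hUc : Continuous U) (hb : ∀ y, ‖U y‖ ≤ C₀) (hby : ∀ y, |⟪U y, y⟫| ≤ C₀)
    (hC₀ : 0 ≤ C₀) (h : GaussL2 E) : solOp hUc hb hby hC₀ h = gaussFstL (solOpV hUc hb hby hC₀ h) := rfl

/-- **`K` is compact** (`V ↪ L²(γ)` is). [folklore] -/
theorem isCompactOperator_solOp (hUc : Continuous U) (hb : ∀ y, ‖U y‖ ≤ C₀) (hby : ∀ y, |⟪U y, y⟫| ≤ C₀)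
    (hC₀ : 0 ≤ C₀) : IsCompactOperator (solOp (E := E) hUc hb hby hC₀) :=
  (isCompactOperator_gaussFstL (E := E)).comp_clm (solOpV hUc hb hby hC₀)

/-- `1 ≠ 0` in `L²(γ)`. [folklore] -/
theorem gaussOne_ne_zero : (gaussOne : GaussL2 E) ≠ 0 := by
  intro h0
  have h1 : ‖(gaussOne : GaussL2 E)‖ ^ 2 = ∫ y : E, gaussWeight y := by
    rw [norm_sq_gaussL2]
    refine integral_congr_ae ?_
    filter_upwards [coeFn_gaussOne] with y hy
    rw [hy]; ring
  rw [h0, norm_zero] at h1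
  have hpos : 0 < ∫ y : E, gaussWeight y := by
    refine (integral_pos_iff_support_of_nonneg (fun y => (gaussWeight_pos y).le) integrable_gaussWeight).2 ?_
    have hs : Function.support (gaussWeight : E → ℝ) = Set.univ := by
      ext y; simp [(gaussWeight_pos y).ne']
    rw [hs]
    exact isOpen_univ.measure_pos volume univ_nonempty
  linarith


/-! ### The drift hypotheses, bundled -/

/-- **Admissible drifts**: `U` smooth, divergence free, with `|U| ≤ C₀` and `|⟪U, y⟫| ≤ C₀`
(for Pineau–Vicol: (1.9) `|U(y)| ≤ C_{U,0}/(1+|y|)` gives both with `C₀ = C_{U,0}`, and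
`∇·U = 0` is (1.8b)). [cite: PineauVicol2026, Prop. 5.1 hypotheses ((1.9), (2.1), ∇·U = 0)] -/
structure DriftHyp (U : E → E) (C₀ : ℝ) : Prop where
  /-- smoothness -/
  contDiff : ContDiff ℝ ∞ U
  /-- incompressibility -/
  div_eq_zero : ∀ y, VectorCalculus.divergence U y = 0
  /-- boundedness -/
  norm_le : ∀ y, ‖U y‖ ≤ C₀
  /-- boundedness of the radial component times `|y|` -/
  abs_inner_le : ∀ y, |⟪U y, y⟫| ≤ C₀

namespace DriftHyp

variable (h : DriftHyp U C₀)
include h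

omit [FiniteDimensional ℝ E] [MeasurableSpace E] [BorelSpace E] in
/-- `C₀ ≥ 0`. [folklore] -/
theorem nonneg : 0 ≤ C₀ := (norm_nonneg _).trans (h.norm_le 0)

omit [FiniteDimensional ℝ E] [MeasurableSpace E] [BorelSpace E] in
/-- `U` is continuous. [folklore] -/
theorem continuous : Continuous U := h.contDiff.continuous

omit [FiniteDimensional ℝ E] [MeasurableSpace E] [BorelSpace E] in
/-- `U` is `C¹`. [folklore] -/
theorem contDiff_one : ContDiff ℝ 1 U := h.contDiff.of_le (mod_cast le_top)

omit [FiniteDimensional ℝ E] [MeasurableSpace E] [BorelSpace E] in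
/-- `|div U| ≤ C₀` (trivially, `div U = 0`). [folklore] -/
theorem abs_div_le (y : E) : |VectorCalculus.divergence U y| ≤ C₀ := by
  rw [h.div_eq_zero y, abs_zero]; exact h.nonneg

/-- The solution operator `K` of the bundled hypotheses. [folklore] -/
def K : GaussL2 E →L[ℝ] GaussL2 E := solOp h.continuous h.norm_le h.abs_inner_le h.nonneg

/-- The `V`-valued solution operator of the bundled hypotheses. [folklore] -/
def KV : GaussL2 E →L[ℝ] gaussGraph (E := E) := solOpV h.continuous h.norm_le h.abs_inner_le h.nonneg

/-- `K = π₁ ∘ K_V`. [folklore] -/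
theorem K_apply (g : GaussL2 E) : h.K g = gaussFstL (h.KV g) := rfl

/-- **Key identity**: for `x = (f, G) ∈ V`, `⟪½⟪U,y⟫ f, 1⟫ = ⟪⟪U, G⟫, 1⟫` — the weak-gradient
identity against `Ψ = U` with `div U = 0` (this is `a(x, (1,0)) = 0`, i.e. `M†1 = 0`). [folklore] -/
theorem inner_mulPotL_gaussOne_eq {x : GaussProd E} (hx : x ∈ gaussGraph (E := E)) :
    ⟪mulPotL h.continuous h.abs_inner_le x.fst, gaussOne⟫ =
      ⟪mulInnerL h.continuous h.norm_le x.snd, gaussOne⟫ := by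
  have key := gaussGraph_integral_inner_eq hx h.contDiff_one h.norm_le h.abs_div_le
  rw [inner_gaussL2, inner_gaussL2]
  have e1 : ∫ y, gaussWeight y * (((mulPotL h.continuous h.abs_inner_le x.fst : GaussL2 E) : E → ℝ) y *
      ((gaussOne : GaussL2 E) : E → ℝ) y) = ∫ y, gaussWeight y * ((x.fst : E → ℝ) y * (⟪U y, y⟫ / 2)) := by
    refine integral_congr_ae ?_
    filter_upwards [ae_gaussMeasure_iff.1 (coeFn_mulPotL h.continuous h.abs_inner_le x.fst),
      coeFn_gaussOne] with y h1 h2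
    rw [h1, h2]; ring
  have e2 : ∫ y, gaussWeight y * (((mulInnerL h.continuous h.norm_le x.snd : GaussL2 E) : E → ℝ) y *
      ((gaussOne : GaussL2 E) : E → ℝ) y) = ∫ y, gaussWeight y * ⟪(x.snd : E → E) y, U y⟫ := by
    refine integral_congr_ae ?_
    filter_upwards [ae_gaussMeasure_iff.1 (coeFn_mulInnerL h.continuous h.norm_le x.snd),
      coeFn_gaussOne] with y h1 h2
    rw [h1, h2, real_inner_comm]; ring
  rw [e1, e2, key, ← integral_neg]
  refine integral_congr_ae (Eventually.of_forall fun y => ?_)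
  simp only [h.div_eq_zero y]
  ring

/-- `a_{μ₀}(x, (1,0)) = μ₀ ⟪x₁, 1⟫` for `x ∈ V`. [folklore] -/
theorem formBilin_gaussOnePair {x : GaussProd E} (hx : x ∈ gaussGraph (E := E)) :
    formBilin h.continuous h.norm_le h.abs_inner_le x gaussOnePair = shiftConst C₀ * ⟪x.fst, gaussOne⟫ := by
  rw [formBilin_apply', gaussOnePair_fst, gaussOnePair_snd, inner_zero_right, h.inner_mulPotL_gaussOne_eq hx]
  ring

/-- **The adjoint of `K` fixes the constants up to `μ₀⁻¹`: `K†1 = μ₀⁻¹ 1`.** [folklore] -/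
theorem adjoint_K_gaussOne :
    ContinuousLinearMap.adjoint h.K gaussOne = (shiftConst C₀)⁻¹ • (gaussOne : GaussL2 E) := by
  refine ext_inner_right ℝ fun g => ?_
  rw [ContinuousLinearMap.adjoint_inner_left, real_inner_smul_left, h.K_apply]
  have h1 := formBilinV_solOpV h.continuous h.norm_le h.abs_inner_le h.nonneg g
    ⟨gaussOnePair, gaussOnePair_mem_gaussGraph⟩
  rw [formBilinV_apply] at h1
  change formBilin h.continuous h.norm_le h.abs_inner_le (h.KV g : GaussProd E) gaussOnePair =
    ⟪g, gaussOne⟫ at h1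
  rw [h.formBilin_gaussOnePair (h.KV g).2] at h1
  have hμ := (shiftConst_pos C₀).ne'
  rw [real_inner_comm (gaussFstL (h.KV g)) gaussOne, real_inner_comm g gaussOne, ← h1, gaussFstL_apply]
  field_simp

/-- **`μ₀⁻¹` is an eigenvalue of the compact operator `K`** — the Fredholm alternative: otherwise
`μ₀⁻¹` would be in the resolvent set of `K`, hence of `K† = K⋆`, contradicting `K†1 = μ₀⁻¹ 1`. [folklore] -/
theorem hasEigenvalue_K :
    Module.End.HasEigenvalue (h.K : Module.End ℝ (GaussL2 E)) (shiftConst C₀)⁻¹ := by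
  have hK := isCompactOperator_solOp (E := E) h.continuous h.norm_le h.abs_inner_le h.nonneg
  rcases hK.hasEigenvalue_or_mem_resolventSet (inv_ne_zero (shiftConst_pos C₀).ne') with he | hr
  · exact he
  · exfalso
    have hadj : Module.End.HasEigenvalue
        ((ContinuousLinearMap.adjoint h.K : GaussL2 E →L[ℝ] GaussL2 E) : Module.End ℝ (GaussL2 E))
        (shiftConst C₀)⁻¹ := by
      refine Module.End.hasEigenvalue_of_hasEigenvector ⟨?_, gaussOne_ne_zero⟩
      rw [Module.End.mem_eigenspace_iff]
      exact h.adjoint_K_gaussOne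
    have hspec := hadj.mem_spectrum
    rw [← ContinuousLinearMap.spectrum_eq] at hspec
    have hr' : (shiftConst C₀)⁻¹ ∈ resolventSet ℝ (star h.K) := by
      rw [← spectrum.star_mem_resolventSet_iff, star_trivial]
      exact hr
    rw [ContinuousLinearMap.star_eq_adjoint] at hr'
    exact hspec hr'

/-- **Existence of a nonzero weak solution in `V`**: there is `x = (f, G) ∈ V`, `f ≠ 0`, with
`a_{μ₀}(x, x') = μ₀⟪f, x'₁⟫` for all `x' ∈ V`, i.e. `a(x, ·) = 0` on `V`. [folklore] -/
theorem exists_weak_solution : ∃ x ∈ gaussGraph (E := E), x.fst ≠ 0 ∧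
    ∀ x' ∈ gaussGraph (E := E), formBilin h.continuous h.norm_le h.abs_inner_le x x' =
      shiftConst C₀ * ⟪x.fst, x'.fst⟫ := by
  obtain ⟨g, hg⟩ := h.hasEigenvalue_K.exists_hasEigenvector
  have hKg : h.K g = (shiftConst C₀)⁻¹ • g := hg.apply_eq_smul
  have hg0 : g ≠ 0 := hg.2
  have hfst : ((h.KV g : GaussProd E)).fst = (shiftConst C₀)⁻¹ • g := by
    rw [← gaussFstL_apply, ← h.K_apply, hKg]
  refine ⟨(h.KV g : GaussProd E), (h.KV g).2, ?_, fun x' hx' => ?_⟩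
  · rw [hfst]
    exact smul_ne_zero (inv_ne_zero (shiftConst_pos C₀).ne') hg0
  · have h1 := formBilinV_solOpV h.continuous h.norm_le h.abs_inner_le h.nonneg g ⟨x', hx'⟩
    rw [formBilinV_apply] at h1
    change formBilin _ _ _ (h.KV g : GaussProd E) x' = ⟪g, x'.fst⟫ at h1
    rw [h1, hfst, real_inner_smul_left]
    field_simp [(shiftConst_pos C₀).ne']

/-- **The weak solution, unbundled.** There are `f ∈ L²(γ)` (not a.e. zero) and `G ∈ L²(γ; E)` such
that `G` is the `γ`-weak gradient of `f` (`∫γ⟪G,Ψ⟫ = −∫γ f (div Ψ − ½⟪Ψ,y⟫)` for bounded `C¹`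
fields with bounded divergence) and the **weak equation**
`∫γ⟪G,∇φ⟫ − ∫γ⟪U,G⟫φ + ∫γ ½⟪U,y⟫ f φ = 0` holds for every smooth compactly supported `φ` — the
weak form of `−Δv + (½y − U)·∇v + ½(U·y)v = 0`, `v = f`, i.e. of `L*(γv) = 0` (Pineau–Vicol 2026,
(5.1)–(5.2)). [cite: PineauVicol2026, Prop. 5.1 / (5.2)] -/
theorem exists_weak_solution_fun : ∃ (f : E → ℝ) (G : E → E),
    MemLp f 2 (gaussMeasure (E := E)) ∧ MemLp G 2 (gaussMeasure (E := E)) ∧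
    (¬ f =ᵐ[volume] 0) ∧
    (∀ (Ψ : E → E) (C : ℝ), ContDiff ℝ 1 Ψ → (∀ y, ‖Ψ y‖ ≤ C) →
      (∀ y, |VectorCalculus.divergence Ψ y| ≤ C) →
        ∫ y, gaussWeight y * ⟪G y, Ψ y⟫ =
          -∫ y, gaussWeight y * (f y * (VectorCalculus.divergence Ψ y - ⟪Ψ y, y⟫ / 2))) ∧
    (∀ φ : E → ℝ, ContDiff ℝ ∞ φ → HasCompactSupport φ →
      (∫ y, gaussWeight y * ⟪G y, gradient φ y⟫) - (∫ y, gaussWeight y * (⟪U y, G y⟫ * φ y)) +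
        (∫ y, gaussWeight y * (⟪U y, y⟫ / 2 * f y * φ y)) = 0) := by
  obtain ⟨x, hx, hx0, hxeq⟩ := h.exists_weak_solution
  refine ⟨(x.fst : E → ℝ), (x.snd : E → E), Lp.memLp _, Lp.memLp _, ?_, ?_, ?_⟩
  · intro h0
    exact hx0 (Lp.eq_zero_iff_ae_eq_zero.2 (gaussMeasure_absolutelyContinuous.ae_le h0))
  · intro Ψ C hΨ hbΨ hdΨ
    exact gaussGraph_integral_inner_eq hx hΨ hbΨ hdΨ
  · intro φ hφ hφc
    set ψ := mkTest φ hφ hφc with hψ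
    have h1 := hxeq (testPair ψ) (testPair_mem_gaussGraph ψ)
    rw [formBilin_apply'] at h1
    have h2 : ⟪mulPotL h.continuous h.abs_inner_le x.fst, (testPair ψ).fst⟫ -
        ⟪mulInnerL h.continuous h.norm_le x.snd, (testPair ψ).fst⟫ + ⟪x.snd, (testPair ψ).snd⟫ = 0 := by
      linarith
    rw [inner_gaussL2, inner_gaussL2, inner_gaussL2Vec] at h2
    have e1 : ∫ y, gaussWeight y * (((mulPotL h.continuous h.abs_inner_le x.fst : GaussL2 E) : E → ℝ) y *
        (((testPair ψ).fst : GaussL2 E) : E → ℝ) y) = ∫ y, gaussWeight y * (⟪U y, y⟫ / 2 * (x.fst : E → ℝ) y * φ y) := by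
      refine integral_congr_ae ?_
      filter_upwards [ae_gaussMeasure_iff.1 (coeFn_mulPotL h.continuous h.abs_inner_le x.fst),
        ae_gaussMeasure_iff.1 (coeFn_testPair_fst ψ)] with y h1 h2
      rw [h1, h2, hψ, coe_mkTest]
    have e2 : ∫ y, gaussWeight y * (((mulInnerL h.continuous h.norm_le x.snd : GaussL2 E) : E → ℝ) y *
        (((testPair ψ).fst : GaussL2 E) : E → ℝ) y) = ∫ y, gaussWeight y * (⟪U y, (x.snd : E → E) y⟫ * φ y) := by
      refine integral_congr_ae ?_
      filter_upwards [ae_gaussMeasure_iff.1 (coeFn_mulInnerL h.continuous h.norm_le x.snd),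
        ae_gaussMeasure_iff.1 (coeFn_testPair_fst ψ)] with y h1 h2
      rw [h1, h2, hψ, coe_mkTest]
    have e3 : ∫ y, gaussWeight y * ⟪((x.snd : GaussL2Vec E) : E → E) y, (((testPair ψ).snd : GaussL2Vec E) : E → E) y⟫ =
        ∫ y, gaussWeight y * ⟪(x.snd : E → E) y, gradient φ y⟫ := by
      refine integral_congr_ae ?_
      filter_upwards [ae_gaussMeasure_iff.1 (coeFn_testPair_snd ψ)] with y h1
      rw [h1, hψ, coe_mkTest]
    rw [e1, e2, e3] at h2
    linarith

end DriftHyp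

end Existence



end PineauVicol2026

end Literature.Analysis.FluidPDE
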